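import Literature.MathematicalPhysics.QuantumFieldTheory.Balaban1983to89.B4RegionCov1518

/-!
# `Balaban1983to89.B4RegionCovUniformMass` — B4 PROPOSITION 2.3 (1.15)–(1.18) AT `A = 0` ON BLOCK UNIONS,
# UNIFORMLY IN THE MASS `m² ≥ 0` (the printed constant-dependence «dependent on d and M only» restored)

**Source.** T. Bałaban, *Regularity and Decay of Lattice Green's Functions*, Commun. Math. Phys. **89**, 571–597 (1983)
(bib key `Balaban1983RegularityDecay`, «B4» of the 1983–89 series), p. 572 ((1.6)) and p. 574 (Proposition 2.3,
(1.15)–(1.18)).  Quoted from the rendered pages `b2b-balaban-ref1/pages/1983-cmp89-regularity-decay/…-p002-x2.png` and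
`…-p004-x2.png` (PDF pp. 2, 4 = journal pp. 572, 574), read as images (2026-08-19).

**WHAT IS PRINTED (verbatim).**  p. 572, (1.6): «G_k(Ω, A) = (−Δ^{η,N}_{A,Ω} + m² + aP_k(A))^{−1}, where m² ≧ 0 and a
is a positive constant close to 1.»  p. 574: «Proposition 2.3 of [1]. There exist positive constants δ₀, c₀, γ₀, γ₁
dependent on d and M only and such that for arbitrary Λ ⊂ Ω^{(k)} = Ω∩Z^d, Λ being a sum of big blocks and for e
sufficiently small, we have γ₀I ≦ Δ^{(k)}(Ω, A) + aL^{−2}P(A) ≦ γ₁I, (1.15) |C_Λ^{(k)}(Ω, A; x, x′)| ≦ c₀ exp(−δ₀|x−x′|),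
x, x′∈Λ. (1.16) In particular the above inequality holds for C^{(k)}(Ω, A). Putting δC_Λ^{(k)}(Ω, A) = C_Λ^{(k)}(Ω, A)
− C^{(k)}(Ω, A), (1.17) we have also |δC_Λ^{(k)}(Ω, A; x, x′)| ≦ c₀ exp(−δ₀(|x−x′| + dist(x, Λ^c) + dist(x′, Λ^c))),
x, x′∈Λ. (1.18)»

**WHAT THIS MODULE DOES.**  The package's `B4RegionCov1518` certifies (1.15)–(1.18) at `A = 0` for every finite union
`Ω^{(k)}` of `L`-blocks by the print's Section-5 route, with constants uniform in the mesh `n ≥ 1` and on a parameter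
WINDOW `a_k ∈ [a₋, a₊]`, `m² ∈ [0, m²₊]`, `a ∈ [a₂₋, a₂₊]`: its condition-(5.6) package `covR_hyp56` has the lower
constant `γ₀ = min(a₋/(8(d+1)+2|m²₊|), 1/8)·min(2,a₂₋)/L²`, which degrades as `m²₊ → ∞`.  In the print `a` («a positive
constant close to 1») and `a_k` («proportional to a», p. 573) are FIXED numbers and `M` (with `L`) a fixed integer, so
the `a_k`-, `a`-windows are parametrisation; but «m² ≧ 0» is free in (1.6) and the printed constants are «dependent on
d and M only» — uniform in the mass.  This module REMOVES THE MASS WINDOW: it proves condition (5.6) for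
`Δ^{(k)}(Ω,0) + aL^{-2}P(0)` with `γ₀ = min(a₋/(8(d+1)+2), 1/8)·min(2,a₂₋)/L²` and the same `c₀`, `κ` as `covR_hyp56`, for
EVERY `m² ≥ 0` (`covR_hyp56_unif`), and re-runs the one-line Section-5 consequences: (1.15) (`cov115_region_form_bounds_unif`),
(1.16) (`cov116_region_sub_decay_unif` and its `Finset`/full variants), (1.17)–(1.18) (`cov118_region_sub_delta_unif`,
`cov118_region_finset_delta_unif`) — the statements of `B4RegionCov1518` §7 with the binder `m² ≤ m²₊` deleted and the
parameter `m²₊` gone.  `covR_hyp56_window_of_unif` recovers the windowed form, so nothing is lost.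

**MECHANISM (the package's; two mass regimes).**  (1.22) at `A = 0` (`B4Prop31Zero.KeffR_form_ge`) reads
`min(a_k/(8(d+1)+2m²), 1/8)·(Σ_{bonds}(δφ)² + m²‖φ‖²) ≤ ⟨φ, Δ^{(k)}(Ω,0)φ⟩`; step 2 of `B4RegionCov1518.covR_form_ge`
keeps only the bond form and so inherits the `m²`-dependent prefactor.  For `m² ≥ 1` keep instead only the MASS term:
`min(a_k/(8(d+1)+2m²), 1/8)·m² ≥ min(a_k/(8(d+1)+2), 1/8)` because `m²/(8(d+1)+2m²)` increases with `m²`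
(`KeffR_form_ge_mass`), and `aL^{-2}P(0) ≥ 0`, `min(2,a)/L² ≤ 1` for `L ≥ 2`; for `m² ≤ 1` use the windowed bound at
`m²₊ = 1` (`covR_form_ge_unif`).  The entry bound (5.4) (`covR_entry_decay`) never depended on `m²`.
REMARK (why this is special to (1.15)): the analogous uniformity is FALSE for (1.22) itself — `Δ^{(k)}(Ω,0) ≤ a_kI`
(`KeffR_form_le`), so no `γ₀` independent of `m²` can give `⟨φ, Δ^{(k)}φ⟩ ≥ γ₀m²‖φ‖²` for all `m² ≥ 0`; the print's
«γ₀ depending on d only» in Proposition 3.1′ presupposes bounded `m²`, and `B4Prop31Zero`'s `m²`-dependent constant is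
the correct typed reading there.  For (1.15)–(1.18) only `γ₀I ≤ …` is needed, and that IS uniform.

**DICTIONARY** = that of `B4RegionCov1518` (nothing new): `Δ^{(k)}(Ω,0)` ↦ `B4Prop31Zero.KeffR n a_k m² Ω`; `P(0)` ↦
`projL L Ω`; `Δ^{(k)}(Ω,0) + aL^{-2}P(0)` ↦ `covR n L a_k a m² Ω`; `X|_Λ` ↦ `covRSub … e` (`e : m → Ω^{(k)}` an injection
with range `Λ`); `C_Λ^{(k)}(Ω,0)` ↦ `(covRSub … e)⁻¹`; `C^{(k)}(Ω,0)` ↦ `(covR …)⁻¹`; (5.6) ↦ `B4Sect5Torus.Hyp56 (rhoS Ω)`;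
`|x − x′|` ↦ the sup-norm `supNorm`; `dist(x, Λ^c)` ↦ `distCS Λ x` (complement inside `Ω^{(k)}`, `inf ∅ = 0`).

**HONEST SCOPE.**  (i) `A = 0` only, exactly as `B4RegionCov1518` (no «e sufficiently small», no (1.7)).  (ii) Regions:
finite unions `Ω^{(k)}` of `L`-blocks of unit sites (`IsBlockUnion (ℓ+1)`), `L = ℓ + 1 ≥ 2`; `Λ` an arbitrary
injection range (the print's «sum of big blocks» proviso dropped, harmless at `A = 0`).  (iii) Constants: EXISTENCE
with `γ₀` explicit; they depend on `d`, `ℓ` and the `a_k`-, `a`-windows and on NOTHING ELSE — in particular not on `m²`,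
which now ranges over all of `[0, ∞)`; no claim about the print's numerical `δ₀, c₀`; no uniformity in `L` is claimed
(`γ₀ ∝ L^{-2}` as printed in (5.3)).  (iv) Norm: sup-norm, as in the whole lineage.  (v) NOT treated here (one-writer
courtesy, recorded in the cell journal): the same swap `covR_hyp56 ↦ covR_hyp56_unif` makes the two-region bound
(1.19)–(1.20) of `B4TwoRegion120.cov120_region_sub_delta` uniform in `m²`; that module is another lineage's.  (vi) This
module touches no existing declaration and discharges no `B4.*Printed` leaf; every `B4RegionCov1518` / `B4Prop31Zero` /
`B4Sect5Torus` / `B4BoxCov237` name is used BY NAME.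

**ABSOLUTE RULE.**  Nothing printed is used as a hypothesis: every statement below is a closed theorem proved from the
package's definitions and kernel theorems (`KeffR_form_ge`, `covR_form_ge`, `covR_form_le`, `covR_form_eq`, `projL_form`,
`covR_entry_decay`, `ctRate_small`, `hyp56_submatrix`, `isUnit_of_hyp56`, `inv_submatrix_decay`, `deltaC_bound`,
`hyp56_mono`); the quotations above only LOCATE what is being certified.  Zero `sorry`, no new axioms.

**Value = kernel certificate (the printed mass-uniformity of the (1.15)–(1.18) constants, at `A = 0`), NOT summit
progress**: the Yang–Mills / `Summit.QuantumFields` statements are untouched; no Literature fact is minted.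
-/

namespace Literature.MathematicalPhysics.QuantumFieldTheory.Balaban1983to89.B4RegionCovUniformMass

open Finset Matrix
open Literature.MathematicalPhysics.QuantumFieldTheory.Balaban1983to89.B4ContourShift (supNorm supNorm_nonneg
  abs_le_supNorm)
open Literature.MathematicalPhysics.QuantumFieldTheory.Balaban1983to89.B4Reflection242
open Literature.MathematicalPhysics.QuantumFieldTheory.Balaban1983to89.B4Green242Bridge
open Literature.MathematicalPhysics.QuantumFieldTheory.Balaban1983to89.B4BoxCov237
open Literature.MathematicalPhysics.QuantumFieldTheory.Balaban1983to89.B4Lower18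
open Literature.MathematicalPhysics.QuantumFieldTheory.Balaban1983to89.B4Prop31Zero
open Literature.MathematicalPhysics.QuantumFieldTheory.Balaban1983to89.B4RegionCov1518
open B4Green244 (finePt)
open B4Sect5Torus (IsPseudoDist SumBound Hyp56 rate rate_pos bigC bigC_nonneg hyp56_submatrix isUnit_of_hyp56
  inv_submatrix_decay deltaC_bound)
open B4Sect5Proof (latticeConst latticeConst_nonneg latticeSum_le)

noncomputable section

variable {d : ℕ}

/-! ## §1  The large-mass regime of (1.22) and the mass-uniform lower bound (1.15) -/

/-- **THE LARGE-MASS REGIME OF (1.22) AT `A = 0`**: for `m² ≥ 1` the MASS TERM of `B4Prop31Zero.KeffR_form_ge` alone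
bounds `Δ^{(k)}(Ω,0)` from below, uniformly in `m²`: `min(a_k/(8(d+1)+2), 1/8)·‖φ‖² ≤ ⟨φ, Δ^{(k)}(Ω,0)φ⟩` — because
`min(a_k/(8(d+1)+2m²), 1/8)·m² ≥ min(a_k/(8(d+1)+2), 1/8)` (`m²/(8(d+1)+2m²)` increases with `m²`).  Every finite
`Ω^{(k)}`, every mesh `n ≥ 1`. [folklore] -/
theorem KeffR_form_ge_mass {n : ℕ} (hn : 1 ≤ n) {a m2 : ℝ} (ha : 0 < a) (hm : 1 ≤ m2)
    (Ω : Finset (Fin (d + 1) → ℤ)) (ψ : ↥Ω → ℝ) :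
    min (a / (8 * (d + 1) + 2)) (1 / 8) * (ψ ⬝ᵥ ψ) ≤ ψ ⬝ᵥ (KeffR n a m2 Ω).mulVec ψ := by
  have hm0 : 0 ≤ m2 := zero_le_one.trans hm
  have hK := KeffR_form_ge hn ha hm0 Ω ψ
  have hD : 0 ≤ dirS Ω (extS Ω ψ) := dirS_nonneg _ _
  have hψ : 0 ≤ ψ ⬝ᵥ ψ := by
    unfold dotProduct
    exact Finset.sum_nonneg fun i _ => mul_self_nonneg _
  have hd : (0 : ℝ) ≤ d := Nat.cast_nonneg d
  have hc0 : 0 ≤ min (a / (8 * (d + 1) + 2 * m2)) (1 / 8) := le_min (by positivity) (by norm_num)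
  have h1 : min (a / (8 * (d + 1) + 2 * m2)) (1 / 8) * (m2 * (ψ ⬝ᵥ ψ)) ≤ ψ ⬝ᵥ (KeffR n a m2 Ω).mulVec ψ :=
    (mul_le_mul_of_nonneg_left (le_add_of_nonneg_left hD) hc0).trans hK
  have h2 : min (a / (8 * (d + 1) + 2)) (1 / 8) ≤ min (a / (8 * (d + 1) + 2 * m2)) (1 / 8) * m2 := by
    rw [min_mul_of_nonneg _ _ hm0]
    refine min_le_min ?_ (by linarith)
    rw [div_mul_eq_mul_div, div_le_div_iff₀ (by positivity) (by positivity)]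
    nlinarith [mul_nonneg (mul_nonneg ha.le hd) (sub_nonneg.2 hm), mul_nonneg ha.le (sub_nonneg.2 hm)]
  calc min (a / (8 * (d + 1) + 2)) (1 / 8) * (ψ ⬝ᵥ ψ)
      ≤ min (a / (8 * (d + 1) + 2 * m2)) (1 / 8) * m2 * (ψ ⬝ᵥ ψ) := mul_le_mul_of_nonneg_right h2 hψ
    _ = min (a / (8 * (d + 1) + 2 * m2)) (1 / 8) * (m2 * (ψ ⬝ᵥ ψ)) := by ring
    _ ≤ _ := h1

/-- **(1.15) AT `A = 0`, LOWER BOUND, UNIFORM IN `m² ≥ 0`** (the print's (5.3) `γ₀min{π²L^{-2}, aL^{-2}}` shape, p. 593,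
with an `m²`-free `γ₀`): for `L ≥ 2`, every finite union `Ω^{(k)}` of `L`-blocks, every mesh and EVERY `m² ≥ 0`,
`min(a_k/(8(d+1)+2), 1/8)·min(2,a)·L^{-2}·‖ψ‖² ≤ ⟨ψ, (Δ^{(k)}(Ω,0) + aL^{-2}P(0))ψ⟩`.  Small mass (`m² ≤ 1`):
`B4RegionCov1518.covR_form_ge`; large mass (`m² ≥ 1`): `KeffR_form_ge_mass`, `aL^{-2}P(0) ≥ 0` (`projL_form`) and
`min(2,a)/L² ≤ 1`. [folklore] -/
theorem covR_form_ge_unif {n L : ℕ} (hn : 1 ≤ n) (hL : 2 ≤ L) {a₁ a₂ m2 : ℝ} (ha : 0 < a₁) (ha2 : 0 ≤ a₂)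
    (hm : 0 ≤ m2) {Ω : Finset (Fin (d + 1) → ℤ)} (hΩ : IsBlockUnion L Ω) (ψ : ↥Ω → ℝ) :
    min (a₁ / (8 * (d + 1) + 2)) (1 / 8) * (min 2 a₂ / (L : ℝ) ^ 2) * (ψ ⬝ᵥ ψ)
      ≤ ψ ⬝ᵥ (covR n L a₁ a₂ m2 Ω).mulVec ψ := by
  have hL1 : 1 ≤ L := le_trans (by norm_num) hL
  have hψ : 0 ≤ ψ ⬝ᵥ ψ := by
    unfold dotProduct
    exact Finset.sum_nonneg fun i _ => mul_self_nonneg _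
  have hγ0 : 0 ≤ min (a₁ / (8 * (d + 1) + 2)) (1 / 8) := le_min (by positivity) (by norm_num)
  have hσ0 : 0 ≤ min 2 a₂ / (L : ℝ) ^ 2 := div_nonneg (le_min (by norm_num) ha2) (by positivity)
  rcases le_total m2 1 with hm1 | hm1
  · have h := covR_form_ge hn hL1 ha ha2 hm hΩ ψ
    refine le_trans (mul_le_mul_of_nonneg_right (mul_le_mul_of_nonneg_right (min_le_min ?_ le_rfl) hσ0) hψ) h
    exact div_le_div_of_nonneg_left ha.le (by positivity) (by linarith)
  · have hK := KeffR_form_ge_mass hn ha hm1 Ω ψ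
    have hP : 0 ≤ ψ ⬝ᵥ (projL L Ω).mulVec ψ := by
      rw [projL_form]
      exact mul_nonneg (by positivity) (Finset.sum_nonneg fun b _ => sq_nonneg _)
    have hcov : ψ ⬝ᵥ (KeffR n a₁ m2 Ω).mulVec ψ ≤ ψ ⬝ᵥ (covR n L a₁ a₂ m2 Ω).mulVec ψ := by
      rw [covR_form_eq]
      have := mul_nonneg (div_nonneg ha2 (sq_nonneg (L : ℝ))) hP
      linarith
    have hfac : min 2 a₂ / (L : ℝ) ^ 2 ≤ 1 := by
      rw [div_le_one (by positivity)]
      have hL2 : (2 : ℝ) ≤ L := by exact_mod_cast hL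
      nlinarith [min_le_left (2 : ℝ) a₂]
    calc min (a₁ / (8 * (d + 1) + 2)) (1 / 8) * (min 2 a₂ / (L : ℝ) ^ 2) * (ψ ⬝ᵥ ψ)
        ≤ min (a₁ / (8 * (d + 1) + 2)) (1 / 8) * 1 * (ψ ⬝ᵥ ψ) :=
          mul_le_mul_of_nonneg_right (mul_le_mul_of_nonneg_left hfac hγ0) hψ
      _ = min (a₁ / (8 * (d + 1) + 2)) (1 / 8) * (ψ ⬝ᵥ ψ) := by ring
      _ ≤ ψ ⬝ᵥ (KeffR n a₁ m2 Ω).mulVec ψ := hK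
      _ ≤ _ := hcov

/-! ## §2  Condition (5.6) for `Δ^{(k)}(Ω,0) + aL^{-2}P(0)`, uniformly in `m² ≥ 0` -/

/-- **CONDITION (5.6) FOR `Δ^{(k)}(Ω,0) + aL^{-2}P(0)`, EVERY FINITE UNION `Ω^{(k)}` OF `L`-BLOCKS, UNIFORMLY IN THE
MESH, THE `a_k`-, `a`-WINDOWS AND IN `m² ≥ 0`** — `B4RegionCov1518.covR_hyp56` without the mass window: there are
`γ₀ > 0`, `c₀ ≥ 0`, `κ > 0` depending on `d`, `ℓ`, `a₋`, `a₊`, `a₂₋`, `a₂₊` ONLY — explicitly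
`γ₀ = min(a₋/(8(d+1)+2), 1/8)·min(2, a₂₋)/L²`, `κ = ctRate d a₋ a₊` — such that for every `n ≥ 1`, every
`a_k ∈ [a₋, a₊]`, EVERY `m² ≥ 0`, every `a ∈ [a₂₋, a₂₊]` and every finite union `Ω^{(k)}` of `L`-blocks the operator is
symmetric, `≥ γ₀` as a form and has entries `≤ c₀e^{−κ|y − y′|_∞}` — the print's «positive constants … dependent on d
and M only» (p. 574) with «m² ≧ 0» free (p. 572 (1.6)).
[cite: Balaban1983RegularityDecay, p. 594 (5.6) for the operator of (1.15) p. 574, case A = 0, constants the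
package's] -/
theorem covR_hyp56_unif (d ℓ : ℕ) (hℓ : 1 ≤ ℓ) (amin aplus a2min a2plus : ℝ) (ha : 0 < amin)
    (ha2 : 0 < a2min) :
    ∃ γ₀ c₀ κ : ℝ, 0 < γ₀ ∧ 0 ≤ c₀ ∧ 0 < κ ∧
      γ₀ = min (amin / (8 * (d + 1) + 2)) (1 / 8) * (min 2 a2min / ((ℓ : ℝ) + 1) ^ 2) ∧
      κ = ctRate d amin aplus ∧
      ∀ (n : ℕ), 1 ≤ n → ∀ (a₁ m2 a₂ : ℝ), amin ≤ a₁ → a₁ ≤ aplus → 0 ≤ m2 →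
        a2min ≤ a₂ → a₂ ≤ a2plus → ∀ (Ω : Finset (Fin (d + 1) → ℤ)), IsBlockUnion (ℓ + 1) Ω →
          Hyp56 (rhoS Ω) (covR n (ℓ + 1) a₁ a₂ m2 Ω) γ₀ c₀ κ := by
  set κ := ctRate d amin aplus with hκdef
  have hκ : 0 < κ := ctRate_pos d aplus ha
  have hκ1 : κ ≤ 1 := ctRate_le_one d amin aplus
  have hσ : 0 < min 2 amin := lt_min (by norm_num) ha
  have hσ2 : 0 < min 2 a2min := lt_min (by norm_num) ha2
  set γ₀ : ℝ := min (amin / (8 * (d + 1) + 2)) (1 / 8) * (min 2 a2min / ((ℓ : ℝ) + 1) ^ 2) with hγ₀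
  set c₀ : ℝ := |aplus| + aplus ^ 2 * (2 / min 2 amin) * Real.exp κ + |a2plus| * Real.exp (κ * ℓ) with hc₀
  have hγ : 0 < γ₀ := mul_pos (lt_min (by positivity) (by norm_num)) (by positivity)
  have hc : 0 ≤ c₀ := by positivity
  refine ⟨γ₀, c₀, κ, hγ, hc, hκ, rfl, rfl, ?_⟩
  intro n hn a₁ m2 a₂ h1 h2 h3 h5 h6 Ω hΩ
  have hL : 1 ≤ ℓ + 1 := by omega
  have hL2 : 2 ≤ ℓ + 1 := by omega
  have ha₁ : 0 < a₁ := lt_of_lt_of_le ha h1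
  have ha₂ : 0 ≤ a₂ := ha2.le.trans h5
  have hsmall := ctRate_small d ha h1 h2
  refine ⟨covR_isSymm n (ℓ + 1) a₁ a₂ m2 Ω, fun v => ?_, fun p q => ?_⟩
  · have hge := covR_form_ge_unif hn hL2 ha₁ ha₂ h3 hΩ v
    push_cast at hge
    have hγle : γ₀ ≤ min (a₁ / (8 * (d + 1) + 2)) (1 / 8) * (min 2 a₂ / ((ℓ : ℝ) + 1) ^ 2) := by
      refine mul_le_mul (min_le_min ?_ le_rfl) ?_ (by positivity) (le_min (by positivity) (by norm_num))
      · exact div_le_div_of_nonneg_right h1 (by positivity)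
      · exact div_le_div_of_nonneg_right (min_le_min le_rfl h5) (by positivity)
    have hvv : ∑ p, v p ^ 2 = v ⬝ᵥ v := by
      unfold dotProduct
      exact Finset.sum_congr rfl fun p _ => by ring
    have hvv0 : 0 ≤ v ⬝ᵥ v := by
      rw [← hvv]
      exact Finset.sum_nonneg fun _ _ => sq_nonneg _
    rw [hvv]
    show γ₀ * (v ⬝ᵥ v) ≤ v ⬝ᵥ (covR n (ℓ + 1) a₁ a₂ m2 Ω).mulVec v
    exact (mul_le_mul_of_nonneg_right hγle hvv0).trans hge
  · unfold rhoS
    have hE := covR_entry_decay hn hL ha₁ ha₂ h3 hκ.le hκ1 hsmall Ω p q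
    push_cast at hE
    simp only [add_sub_cancel_right] at hE
    have hX := Real.exp_pos (-(κ * supNorm (p.1 - q.1)))
    have hLL : a₂ / ((ℓ : ℝ) + 1) ^ 2 ≤ |a2plus| :=
      calc a₂ / ((ℓ : ℝ) + 1) ^ 2 ≤ a₂ := div_le_self ha₂ (one_le_pow₀ (by linarith))
        _ ≤ a2plus := h6
        _ ≤ |a2plus| := le_abs_self _
    have hK2 : a₁ + a₁ ^ 2 * (2 / min 2 a₁) * Real.exp κ ≤ |aplus| + aplus ^ 2 * (2 / min 2 amin) * Real.exp κ := by
      have hsq : a₁ ^ 2 ≤ aplus ^ 2 := pow_le_pow_left₀ ha₁.le h2 2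
      have habs : a₁ ≤ |aplus| := h2.trans (le_abs_self _)
      have hσ₁ : 0 < min 2 a₁ := lt_min (by norm_num) ha₁
      have hdiv : 2 / min 2 a₁ ≤ 2 / min 2 amin :=
        div_le_div_of_nonneg_left (by norm_num) hσ (min_le_min le_rfl h1)
      have hprod : a₁ ^ 2 * (2 / min 2 a₁) ≤ aplus ^ 2 * (2 / min 2 amin) :=
        mul_le_mul hsq hdiv (by positivity) (by positivity)
      have := mul_le_mul_of_nonneg_right hprod (Real.exp_pos κ).le
      linarith
    calc |covR n (ℓ + 1) a₁ a₂ m2 Ω p q|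
        ≤ (a₁ + a₁ ^ 2 * (2 / min 2 a₁) * Real.exp κ + a₂ / ((ℓ : ℝ) + 1) ^ 2 * Real.exp (κ * ℓ))
            * Real.exp (-(κ * supNorm (p.1 - q.1))) := hE
      _ ≤ (|aplus| + aplus ^ 2 * (2 / min 2 amin) * Real.exp κ + |a2plus| * Real.exp (κ * ℓ))
            * Real.exp (-(κ * supNorm (p.1 - q.1))) := by
          refine mul_le_mul_of_nonneg_right (add_le_add hK2 ?_) hX.le
          exact mul_le_mul_of_nonneg_right hLL (by positivity)
      _ = c₀ * Real.exp (-(κ * supNorm (p.1 - q.1))) := by rw [hc₀]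

/-- the mass-uniform (5.6) package implies the windowed one of `B4RegionCov1518.covR_hyp56` on every mass window
`[0, m²₊]` (with the window-free `γ₀`), so nothing is lost by the swap. [folklore] -/
theorem covR_hyp56_window_of_unif (d ℓ : ℕ) (hℓ : 1 ≤ ℓ) (amin aplus m2max a2min a2plus : ℝ) (ha : 0 < amin)
    (ha2 : 0 < a2min) :
    ∃ γ₀ c₀ κ : ℝ, 0 < γ₀ ∧ 0 ≤ c₀ ∧ 0 < κ ∧
      γ₀ = min (amin / (8 * (d + 1) + 2)) (1 / 8) * (min 2 a2min / ((ℓ : ℝ) + 1) ^ 2) ∧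
      κ = ctRate d amin aplus ∧
      ∀ (n : ℕ), 1 ≤ n → ∀ (a₁ m2 a₂ : ℝ), amin ≤ a₁ → a₁ ≤ aplus → 0 ≤ m2 →
        m2 ≤ m2max → a2min ≤ a₂ → a₂ ≤ a2plus → ∀ (Ω : Finset (Fin (d + 1) → ℤ)), IsBlockUnion (ℓ + 1) Ω →
          Hyp56 (rhoS Ω) (covR n (ℓ + 1) a₁ a₂ m2 Ω) γ₀ c₀ κ := by
  obtain ⟨γ₀, c₀, κ, hγ, hc, hκ, hγ₀, hκ₀, h⟩ := covR_hyp56_unif d ℓ hℓ amin aplus a2min a2plus ha ha2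
  exact ⟨γ₀, c₀, κ, hγ, hc, hκ, hγ₀, hκ₀, fun n hn a₁ m2 a₂ h1 h2 h3 _ h5 h6 Ω hΩ =>
    h n hn a₁ m2 a₂ h1 h2 h3 h5 h6 Ω hΩ⟩

/-! ## §3  Proposition 2.3 (1.15)–(1.18) at `A = 0`, uniformly in `m² ≥ 0` -/

/-- **B4 PROPOSITION 2.3 (1.15) AT `A = 0`, EVERY FINITE UNION `Ω^{(k)}` OF `L`-BLOCKS, UNIFORMLY IN `m² ≥ 0` —
HYPOTHESIS-FREE.**  For every dimension `d + 1`, block size `L = ℓ + 1 ≥ 2` and `a_k`-, `a`-windows there are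
`γ₀, γ₁ > 0` (`γ₀ = min(a₋/(8(d+1)+2), 1/8)·min(2,a₂₋)/L²`, `γ₁ = |a₊| + |a₂₊| + 1`) such that for EVERY `n ≥ 1`, every
`a_k ∈ [a₋, a₊]`, EVERY `m² ≥ 0`, every `a ∈ [a₂₋, a₂₊]` and every finite union `Ω^{(k)}` of `L`-blocks:
`γ₀‖ψ‖² ≤ ⟨ψ, (Δ^{(k)}(Ω,0) + aL^{-2}P(0))ψ⟩ ≤ γ₁‖ψ‖²`.
[cite: Balaban1983RegularityDecay, p. 574 Proposition 2.3 (1.15) («γ₀I ≦ Δ^{(k)}(Ω, A) + aL^{−2}P(A) ≦ γ₁I» with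
«constants … dependent on d and M only»), case A = 0] -/
theorem cov115_region_form_bounds_unif (d ℓ : ℕ) (hℓ : 1 ≤ ℓ) (amin aplus a2min a2plus : ℝ) (ha : 0 < amin)
    (ha2 : 0 < a2min) :
    ∃ γ₀ γ₁ : ℝ, 0 < γ₀ ∧ 0 < γ₁ ∧
      γ₀ = min (amin / (8 * (d + 1) + 2)) (1 / 8) * (min 2 a2min / ((ℓ : ℝ) + 1) ^ 2) ∧
      ∀ (n : ℕ), 1 ≤ n → ∀ (a₁ m2 a₂ : ℝ), amin ≤ a₁ → a₁ ≤ aplus → 0 ≤ m2 →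
        a2min ≤ a₂ → a₂ ≤ a2plus → ∀ (Ω : Finset (Fin (d + 1) → ℤ)), IsBlockUnion (ℓ + 1) Ω →
          ∀ ψ : ↥Ω → ℝ,
            γ₀ * (ψ ⬝ᵥ ψ) ≤ ψ ⬝ᵥ (covR n (ℓ + 1) a₁ a₂ m2 Ω).mulVec ψ ∧
            ψ ⬝ᵥ (covR n (ℓ + 1) a₁ a₂ m2 Ω).mulVec ψ ≤ γ₁ * (ψ ⬝ᵥ ψ) := by
  obtain ⟨γ₀, c₀, κ, hγ, -, -, hγ₀, -, hA⟩ := covR_hyp56_unif d ℓ hℓ amin aplus a2min a2plus ha ha2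
  refine ⟨γ₀, |aplus| + |a2plus| + 1, hγ, by positivity, hγ₀, ?_⟩
  intro n hn a₁ m2 a₂ h1 h2 h3 h5 h6 Ω hΩ ψ
  have hL : 1 ≤ ℓ + 1 := by omega
  have ha₁ : 0 < a₁ := lt_of_lt_of_le ha h1
  have ha₂ : 0 ≤ a₂ := ha2.le.trans h5
  have hvv : ∑ p, ψ p ^ 2 = ψ ⬝ᵥ ψ := by
    unfold dotProduct
    exact Finset.sum_congr rfl fun p _ => by ring
  have hvv0 : 0 ≤ ψ ⬝ᵥ ψ := by
    rw [← hvv]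
    exact Finset.sum_nonneg fun _ _ => sq_nonneg _
  refine ⟨?_, ?_⟩
  · have h := (hA n hn a₁ m2 a₂ h1 h2 h3 h5 h6 Ω hΩ).2.1 ψ
    rw [hvv] at h
    simpa [dotProduct] using h
  · have h := covR_form_le hn hL ha₁ ha₂ h3 hΩ ψ
    push_cast at h
    have hL2 : a₂ / ((ℓ : ℝ) + 1) ^ 2 ≤ |a2plus| :=
      calc a₂ / ((ℓ : ℝ) + 1) ^ 2 ≤ a₂ := div_le_self ha₂ (one_le_pow₀ (by linarith))
        _ ≤ a2plus := h6
        _ ≤ |a2plus| := le_abs_self _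
    have hK2 : a₁ ≤ |aplus| := h2.trans (le_abs_self _)
    have : (a₁ + a₂ / ((ℓ : ℝ) + 1) ^ 2) * (ψ ⬝ᵥ ψ) ≤ (|aplus| + |a2plus| + 1) * (ψ ⬝ᵥ ψ) :=
      mul_le_mul_of_nonneg_right (by linarith) hvv0
    exact h.trans this

/-- **B4 PROPOSITION 2.3 (1.16) AT `A = 0`, EVERY FINITE UNION `Ω^{(k)}` OF `L`-BLOCKS, EVERY `Λ ⊆ Ω^{(k)}`, UNIFORMLY
IN `m² ≥ 0` — HYPOTHESIS-FREE.**  There are `δ₀, c₀ > 0` depending on `d`, `ℓ` and the `a_k`-, `a`-windows only such that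
for EVERY `n ≥ 1`, every `a_k ∈ [a₋, a₊]`, EVERY `m² ≥ 0`, every `a ∈ [a₂₋, a₂₊]`, every finite union `Ω^{(k)}` of
`L`-blocks and every injection `e : m → Ω^{(k)}` (range `Λ`): `(Δ^{(k)}(Ω,0) + aL^{-2}P(0))|_Λ` is invertible and
`|C_Λ^{(k)}(Ω, 0; e i, e i′)| ≤ c₀·e^{−δ₀|e i − e i′|_∞}`.  Mechanism: `B4Sect5Torus.inv_submatrix_decay` ((5.7)) applied to
`covR_hyp56_unif` — the proof of `B4RegionCov1518.cov116_region_sub_decay` verbatim.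
[cite: Balaban1983RegularityDecay, p. 574 Proposition 2.3 (1.16) («|C_Λ^{(k)}(Ω, A; x, x′)| ≦ c₀ exp(−δ₀|x−x′|),
x, x′∈Λ»), p. 594 (5.6)–(5.7), case A = 0] -/
theorem cov116_region_sub_decay_unif (d ℓ : ℕ) (hℓ : 1 ≤ ℓ) (amin aplus a2min a2plus : ℝ) (ha : 0 < amin)
    (ha2 : 0 < a2min) :
    ∃ δ c : ℝ, 0 < δ ∧ 0 < c ∧ ∀ (n : ℕ), 1 ≤ n → ∀ (a₁ m2 a₂ : ℝ), amin ≤ a₁ → a₁ ≤ aplus → 0 ≤ m2 →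
      a2min ≤ a₂ → a₂ ≤ a2plus → ∀ (Ω : Finset (Fin (d + 1) → ℤ)), IsBlockUnion (ℓ + 1) Ω →
        ∀ {m : Type*} [Fintype m] [DecidableEq m] (e : m → ↥Ω), Function.Injective e →
          covRSub n (ℓ + 1) a₁ a₂ m2 Ω e * (covRSub n (ℓ + 1) a₁ a₂ m2 Ω e)⁻¹ = 1 ∧
          ∀ i i' : m, |(covRSub n (ℓ + 1) a₁ a₂ m2 Ω e)⁻¹ i i'|
            ≤ c * Real.exp (-(δ * supNorm ((e i).1 - (e i').1))) := by
  obtain ⟨γ₀, c₀, κ, hγ, hc, hκ, -, -, hA⟩ := covR_hyp56_unif d ℓ hℓ amin aplus a2min a2plus ha ha2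
  have hKn : ∀ a : ℝ, 0 < a → 0 ≤ latticeConst (d + 1) a := fun a ha => latticeConst_nonneg (d + 1) ha.le
  refine ⟨rate (latticeConst (d + 1)) γ₀ c₀ κ, 2 / γ₀, rate_pos hKn hγ hc hκ, by positivity, ?_⟩
  intro n hn a₁ m2 a₂ h1 h2 h3 h5 h6 Ω hΩ m _ _ e he
  have hAΩ := hA n hn a₁ m2 a₂ h1 h2 h3 h5 h6 Ω hΩ
  have hAe := hyp56_submatrix hAΩ he
  refine ⟨Matrix.mul_nonsing_inv _ ((Matrix.isUnit_iff_isUnit_det _).1 (isUnit_of_hyp56 hγ hAe)), fun i i' => ?_⟩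
  exact inv_submatrix_decay hKn hγ hc hκ (rhoS_isPseudoDist Ω) (rhoS_sumBound Ω) hAΩ he i i'

/-- **(1.16) at `A = 0`, `Λ ⊆ Ω^{(k)}` a `Finset` of unit sites, uniformly in `m² ≥ 0`**, constants of
`cov116_region_sub_decay_unif`. [cite: Balaban1983RegularityDecay, p. 574 Proposition 2.3 (1.16), p. 573 (1.13),
case A = 0] -/
theorem cov116_region_finset_decay_unif (d ℓ : ℕ) (hℓ : 1 ≤ ℓ) (amin aplus a2min a2plus : ℝ) (ha : 0 < amin)
    (ha2 : 0 < a2min) :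
    ∃ δ c : ℝ, 0 < δ ∧ 0 < c ∧ ∀ (n : ℕ), 1 ≤ n → ∀ (a₁ m2 a₂ : ℝ), amin ≤ a₁ → a₁ ≤ aplus → 0 ≤ m2 →
      a2min ≤ a₂ → a₂ ≤ a2plus → ∀ (Ω : Finset (Fin (d + 1) → ℤ)), IsBlockUnion (ℓ + 1) Ω →
        ∀ Λ : Finset ↥Ω,
          covRSub n (ℓ + 1) a₁ a₂ m2 Ω (fun y : ↥Λ => y.1) * (covRSub n (ℓ + 1) a₁ a₂ m2 Ω (fun y : ↥Λ => y.1))⁻¹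
            = 1 ∧
          ∀ y y' : ↥Λ, |(covRSub n (ℓ + 1) a₁ a₂ m2 Ω (fun y : ↥Λ => y.1))⁻¹ y y'|
            ≤ c * Real.exp (-(δ * supNorm (y.1.1 - y'.1.1))) := by
  obtain ⟨δ, c, hδ, hc, h⟩ := cov116_region_sub_decay_unif d ℓ hℓ amin aplus a2min a2plus ha ha2
  refine ⟨δ, c, hδ, hc, ?_⟩
  intro n hn a₁ m2 a₂ h1 h2 h3 h5 h6 Ω hΩ Λ
  exact h n hn a₁ m2 a₂ h1 h2 h3 h5 h6 Ω hΩ (fun y : ↥Λ => y.1) Subtype.val_injective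

/-- **(1.16) at `A = 0` with `Λ = Ω^{(k)}` («In particular the above inequality holds for C^{(k)}(Ω, A)»), uniformly in
`m² ≥ 0`**: `C^{(k)}(Ω, 0)` exists and `|C^{(k)}(Ω, 0; y, y′)| ≤ c₀·e^{−δ₀|y − y′|_∞}`, constants of
`cov116_region_sub_decay_unif`. [cite: Balaban1983RegularityDecay, p. 574 Proposition 2.3 (1.16) with Λ = Ω^{(k)},
case A = 0] -/
theorem cov116_region_decay_unif (d ℓ : ℕ) (hℓ : 1 ≤ ℓ) (amin aplus a2min a2plus : ℝ) (ha : 0 < amin)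
    (ha2 : 0 < a2min) :
    ∃ δ c : ℝ, 0 < δ ∧ 0 < c ∧ ∀ (n : ℕ), 1 ≤ n → ∀ (a₁ m2 a₂ : ℝ), amin ≤ a₁ → a₁ ≤ aplus → 0 ≤ m2 →
      a2min ≤ a₂ → a₂ ≤ a2plus → ∀ (Ω : Finset (Fin (d + 1) → ℤ)), IsBlockUnion (ℓ + 1) Ω →
        covR n (ℓ + 1) a₁ a₂ m2 Ω * (covR n (ℓ + 1) a₁ a₂ m2 Ω)⁻¹ = 1 ∧
        ∀ y y' : ↥Ω, |(covR n (ℓ + 1) a₁ a₂ m2 Ω)⁻¹ y y'| ≤ c * Real.exp (-(δ * supNorm (y.1 - y'.1))) := by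
  obtain ⟨δ, c, hδ, hc, h⟩ := cov116_region_sub_decay_unif d ℓ hℓ amin aplus a2min a2plus ha ha2
  refine ⟨δ, c, hδ, hc, ?_⟩
  intro n hn a₁ m2 a₂ h1 h2 h3 h5 h6 Ω hΩ
  exact h n hn a₁ m2 a₂ h1 h2 h3 h5 h6 Ω hΩ (id : ↥Ω → ↥Ω) Function.injective_id

/-- **B4 PROPOSITION 2.3 (1.17)–(1.18) AT `A = 0`, EVERY FINITE UNION `Ω^{(k)}` OF `L`-BLOCKS, EVERY `Λ ⊆ Ω^{(k)}`,
UNIFORMLY IN `m² ≥ 0` — HYPOTHESIS-FREE.**  There are `δ′, c′ > 0` depending on `d`, `ℓ` and the `a_k`-, `a`-windows only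
such that for EVERY `n ≥ 1`, every `a_k ∈ [a₋, a₊]`, EVERY `m² ≥ 0`, every `a ∈ [a₂₋, a₂₊]`, every finite union `Ω^{(k)}`
of `L`-blocks, every injection `e : m → Ω^{(k)}` (range `Λ`) and every weight `β` with `0 ≤ β i ≤ |e i − z|_∞` for all
`z ∈ Ω^{(k)}` off the range: `|C_Λ^{(k)}(Ω, 0; e i, e i′) − C^{(k)}(Ω, 0; e i, e i′)| ≤ c′·e^{−δ′(|e i − e i′|_∞ + β i + β i′)}`.
Mechanism: `B4Sect5Torus.deltaC_bound` ((5.8)) applied to `covR_hyp56_unif` — the proof of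
`B4RegionCov1518.cov118_region_sub_delta` verbatim.
[cite: Balaban1983RegularityDecay, p. 574 (1.17)–(1.18) («|δC_Λ^{(k)}(Ω, A; x, x′)| ≦ c₀ exp(−δ₀(|x−x′| + dist(x, Λ^c)
+ dist(x′, Λ^c))), x, x′∈Λ»), p. 594 (5.8), case A = 0] -/
theorem cov118_region_sub_delta_unif (d ℓ : ℕ) (hℓ : 1 ≤ ℓ) (amin aplus a2min a2plus : ℝ) (ha : 0 < amin)
    (ha2 : 0 < a2min) :
    ∃ δ c : ℝ, 0 < δ ∧ 0 < c ∧ ∀ (n : ℕ), 1 ≤ n → ∀ (a₁ m2 a₂ : ℝ), amin ≤ a₁ → a₁ ≤ aplus → 0 ≤ m2 →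
      a2min ≤ a₂ → a₂ ≤ a2plus → ∀ (Ω : Finset (Fin (d + 1) → ℤ)), IsBlockUnion (ℓ + 1) Ω →
        ∀ {m : Type*} [Fintype m] [DecidableEq m] (e : m → ↥Ω), Function.Injective e →
          ∀ β : m → ℝ, (∀ i, 0 ≤ β i) → (∀ i (z : ↥Ω), (¬ ∃ j, e j = z) → β i ≤ supNorm ((e i).1 - z.1)) →
            ∀ i i' : m,
              |(covRSub n (ℓ + 1) a₁ a₂ m2 Ω e)⁻¹ i i' - (covR n (ℓ + 1) a₁ a₂ m2 Ω)⁻¹ (e i) (e i')|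
                ≤ c * Real.exp (-(δ * (supNorm ((e i).1 - (e i').1) + β i + β i'))) := by
  obtain ⟨γ₀, c₀, κ, hγ, hc, hκ, -, -, hA⟩ := covR_hyp56_unif d ℓ hℓ amin aplus a2min a2plus ha ha2
  have hKn : ∀ a : ℝ, 0 < a → 0 ≤ latticeConst (d + 1) a := fun a ha => latticeConst_nonneg (d + 1) ha.le
  have hc1 : 0 < c₀ + 1 := by linarith
  have hB := bigC_nonneg hKn hγ hc1.le hκ (K := latticeConst (d + 1))
  refine ⟨rate (latticeConst (d + 1)) γ₀ (c₀ + 1) κ / 4, bigC (latticeConst (d + 1)) γ₀ (c₀ + 1) κ + 1,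
    by have := rate_pos hKn hγ hc1.le hκ; positivity, by positivity, ?_⟩
  intro n hn a₁ m2 a₂ h1 h2 h3 h5 h6 Ω hΩ m _ _ e he β hβ0 hβ i i'
  have hA' := hyp56_mono (hA n hn a₁ m2 a₂ h1 h2 h3 h5 h6 Ω hΩ) (by linarith : c₀ ≤ c₀ + 1)
  have h := deltaC_bound hKn hγ hc1 hκ (rhoS_isPseudoDist Ω) (rhoS_sumBound Ω) hA' he hβ0
    (fun i z hz => by show β i ≤ supNorm ((e i).1 - z.1); exact hβ i z hz) i i'
  refine h.trans ?_
  exact mul_le_mul_of_nonneg_right (le_add_of_nonneg_right zero_le_one) (Real.exp_pos _).le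

/-- **(1.17)–(1.18) at `A = 0` for a `Finset` `Λ ⊆ Ω^{(k)}` with the printed weight `dist(·, Λ^c)`** (`distCS`,
complement inside `Ω^{(k)}`), uniformly in `m² ≥ 0`, constants of `cov118_region_sub_delta_unif`.
[cite: Balaban1983RegularityDecay, p. 574 (1.17)–(1.18), case A = 0] -/
theorem cov118_region_finset_delta_unif (d ℓ : ℕ) (hℓ : 1 ≤ ℓ) (amin aplus a2min a2plus : ℝ) (ha : 0 < amin)
    (ha2 : 0 < a2min) :
    ∃ δ c : ℝ, 0 < δ ∧ 0 < c ∧ ∀ (n : ℕ), 1 ≤ n → ∀ (a₁ m2 a₂ : ℝ), amin ≤ a₁ → a₁ ≤ aplus → 0 ≤ m2 →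
      a2min ≤ a₂ → a₂ ≤ a2plus → ∀ (Ω : Finset (Fin (d + 1) → ℤ)), IsBlockUnion (ℓ + 1) Ω →
        ∀ Λ : Finset ↥Ω, ∀ y y' : ↥Λ,
          |(covRSub n (ℓ + 1) a₁ a₂ m2 Ω (fun y : ↥Λ => y.1))⁻¹ y y' - (covR n (ℓ + 1) a₁ a₂ m2 Ω)⁻¹ y.1 y'.1|
            ≤ c * Real.exp (-(δ * (supNorm (y.1.1 - y'.1.1) + distCS Λ y.1 + distCS Λ y'.1))) := by
  obtain ⟨δ, c, hδ, hc, h⟩ := cov118_region_sub_delta_unif d ℓ hℓ amin aplus a2min a2plus ha ha2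
  refine ⟨δ, c, hδ, hc, ?_⟩
  intro n hn a₁ m2 a₂ h1 h2 h3 h5 h6 Ω hΩ Λ y y'
  refine h n hn a₁ m2 a₂ h1 h2 h3 h5 h6 Ω hΩ (fun y : ↥Λ => y.1) Subtype.val_injective
    (fun y : ↥Λ => distCS Λ y.1) (fun y => distCS_nonneg Λ y.1) (fun w z hz => distCS_le Λ w.1 ?_) y y'
  intro hzΛ
  exact hz ⟨⟨z, hzΛ⟩, rfl⟩

/-! ## §4  Non-vacuity WITHOUT a mass window (`d + 1 = 4`, `L = 2`, `a_k ∈ [1/2, 2]`, `a ∈ [1/2, 2]`, every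
`m² ≥ 0`) -/

/-- non-vacuity: (1.15) at `A = 0` for every finite union `Ω^{(k)} ⊂ ℤ⁴` of `2`-blocks and EVERY `m² ≥ 0`. -/
example : ∃ γ₀ γ₁ : ℝ, 0 < γ₀ ∧ 0 < γ₁ ∧
    γ₀ = min ((1 / 2 : ℝ) / (8 * (((3 : ℕ) : ℝ) + 1) + 2)) (1 / 8) * (min 2 (1 / 2 : ℝ) / (((1 : ℕ) : ℝ) + 1) ^ 2) ∧
    ∀ (n : ℕ), 1 ≤ n → ∀ (a₁ m2 a₂ : ℝ), (1 / 2 : ℝ) ≤ a₁ → a₁ ≤ 2 → 0 ≤ m2 → (1 / 2 : ℝ) ≤ a₂ →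
      a₂ ≤ 2 → ∀ (Ω : Finset (Fin (3 + 1) → ℤ)), IsBlockUnion (1 + 1) Ω → ∀ ψ : ↥Ω → ℝ,
        γ₀ * (ψ ⬝ᵥ ψ) ≤ ψ ⬝ᵥ (covR n (1 + 1) a₁ a₂ m2 Ω).mulVec ψ ∧
        ψ ⬝ᵥ (covR n (1 + 1) a₁ a₂ m2 Ω).mulVec ψ ≤ γ₁ * (ψ ⬝ᵥ ψ) :=
  cov115_region_form_bounds_unif 3 1 le_rfl (1 / 2) 2 (1 / 2) 2 (by norm_num) (by norm_num)

/-- non-vacuity: (1.16) at `A = 0` for every `Finset` `Λ` of unit sites of every finite union `Ω^{(k)} ⊂ ℤ⁴` of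
`2`-blocks and EVERY `m² ≥ 0`. -/
example : ∃ δ c : ℝ, 0 < δ ∧ 0 < c ∧ ∀ (n : ℕ), 1 ≤ n → ∀ (a₁ m2 a₂ : ℝ), (1 / 2 : ℝ) ≤ a₁ → a₁ ≤ 2 → 0 ≤ m2 →
    (1 / 2 : ℝ) ≤ a₂ → a₂ ≤ 2 → ∀ (Ω : Finset (Fin (3 + 1) → ℤ)), IsBlockUnion (1 + 1) Ω →
      ∀ Λ : Finset ↥Ω,
        covRSub n (1 + 1) a₁ a₂ m2 Ω (fun y : ↥Λ => y.1) * (covRSub n (1 + 1) a₁ a₂ m2 Ω (fun y : ↥Λ => y.1))⁻¹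
          = 1 ∧
        ∀ y y' : ↥Λ, |(covRSub n (1 + 1) a₁ a₂ m2 Ω (fun y : ↥Λ => y.1))⁻¹ y y'|
          ≤ c * Real.exp (-(δ * supNorm (y.1.1 - y'.1.1))) :=
  cov116_region_finset_decay_unif 3 1 le_rfl (1 / 2) 2 (1 / 2) 2 (by norm_num) (by norm_num)

/-- non-vacuity: (1.17)–(1.18) at `A = 0` for every `Finset` `Λ` of unit sites of every finite union `Ω^{(k)} ⊂ ℤ⁴`
of `2`-blocks and EVERY `m² ≥ 0`. -/
example : ∃ δ c : ℝ, 0 < δ ∧ 0 < c ∧ ∀ (n : ℕ), 1 ≤ n → ∀ (a₁ m2 a₂ : ℝ), (1 / 2 : ℝ) ≤ a₁ → a₁ ≤ 2 → 0 ≤ m2 →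
    (1 / 2 : ℝ) ≤ a₂ → a₂ ≤ 2 → ∀ (Ω : Finset (Fin (3 + 1) → ℤ)), IsBlockUnion (1 + 1) Ω →
      ∀ Λ : Finset ↥Ω, ∀ y y' : ↥Λ,
        |(covRSub n (1 + 1) a₁ a₂ m2 Ω (fun y : ↥Λ => y.1))⁻¹ y y' - (covR n (1 + 1) a₁ a₂ m2 Ω)⁻¹ y.1 y'.1|
          ≤ c * Real.exp (-(δ * (supNorm (y.1.1 - y'.1.1) + distCS Λ y.1 + distCS Λ y'.1))) :=
  cov118_region_finset_delta_unif 3 1 le_rfl (1 / 2) 2 (1 / 2) 2 (by norm_num) (by norm_num)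

/-- non-vacuity of the large-mass regime: the lower bound (1.15) at `m² = 1000` for every finite union of `2`-blocks
of `ℤ⁴`, with the SAME `m²`-free constant `min((1/2)/(8·4+2), 1/8)·min(2,1/2)/2²`. -/
example (n : ℕ) (hn : 1 ≤ n) (Ω : Finset (Fin (3 + 1) → ℤ)) (hΩ : IsBlockUnion 2 Ω) (ψ : ↥Ω → ℝ) :
    min ((1 / 2 : ℝ) / (8 * ((3 : ℕ) + 1) + 2)) (1 / 8) * (min 2 (1 / 2 : ℝ) / ((2 : ℕ) : ℝ) ^ 2) * (ψ ⬝ᵥ ψ)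
      ≤ ψ ⬝ᵥ (covR n 2 (1 / 2) (1 / 2) 1000 Ω).mulVec ψ :=
  covR_form_ge_unif hn le_rfl (by norm_num) (by norm_num) (by norm_num) hΩ ψ

end

end Literature.MathematicalPhysics.QuantumFieldTheory.Balaban1983to89.B4RegionCovUniformMass
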